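import Mathlib
import Literature.Analysis.FluidPDE.CompressibleEulerImplosionComplexField
import HarnessLib

/-!
# Buckmaster–Cao-Labora–Gómez-Serrano at `γ = 5/3`, complex time: the LOCAL (structured) Lipschitz constant of the field

Companion of `CompressibleEulerImplosionComplexField` (`cfield = (N_W/D_W, N_Z/D_Z)` on `ℂ²`, tube sets, the coarse constant
`lipK`). The coarse constant bounds `sup|N|·Lip D + sup|D|·Lip N` over the whole tube set and divides by `(inf|D|)²`; near the sonic
point this loses the sign cancellation inside the derivative `(N_y D − N D_y)/D²` and is two orders of magnitude above the true
Lipschitz constant (measured: 2100 against 7.2 on the disc of radius 0.175 at `x = −0.7` of the pinned profile). What the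
a-posteriori disc theorem (`Literature.Analysis.ODE.exists_holomorphic_solution_in_tube`) actually needs is a Lipschitz bound between
two points of the SAME tube cross-section, a sup-norm ball of small radius `g` around a point `p = ŷ(z)` of the candidate: here the
exact algebraic expansion of the quadratic numerators around `p`,
`N(p+α)D(p+β) − N(p+β)D(p+α) = (D(p)∇N(p) − N(p)∇D)(α − β) + D(p)(Q(α) − Q(β)) + [(Lα)(ℓβ) − (Lβ)(ℓα)] + [Q(α)ℓβ − Q(β)ℓα]`
(`L = ∇N(p)`, `Q` the quadratic part, `ℓ = ∇D`), gives the STRUCTURED constant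
`K_i(p, g) = ( |n_{i,W}(p)| + |n_{i,Z}(p)| + (8/3)|D_i(p)| g + 2(|∂_W N_i(p)| + |∂_Z N_i(p)|) g + 4 g² ) / (|D_i(p)| − g)²`,
`n_i = D_i ∇N_i − N_i ∇D_i` (the numerator of the derivative of `N_i/D_i`), whose disc-sups are kernel-computable polynomial bounds.
Contents: the gradients `cNW_W, cNW_Z, cNZ_W, cNZ_Z`, the quadratic parts `qNW, qNZ`, the expansion identities `cNW_expand`,
`cNZ_expand`, the numerators `numWW, numWZ, numZW, numZZ`, the constant `lipLoc`, and `lipschitz_cfield_local` (pure algebra + triangle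
inequalities; no convexity, no derivatives). No facts.
[cite: BuckmasterCaolaboraGomezserrano2025, §1.3 eq. (1.8); Hille1976, §2.3]
-/

noncomputable section

open Set Metric

namespace Literature.Analysis.FluidPDE

namespace BuckmasterCaolaboraGomezserrano2025

namespace Monatomic

namespace ComplexDisc

/-! ### Gradients and quadratic parts -/

/-- `∂N_W/∂W = −(r + 5W/3 + Z/3)`. [cite: BuckmasterCaolaboraGomezserrano2025, §2.1] -/
def cNW_W (r : ℝ) (W Z : ℂ) : ℂ := -((r : ℂ) + 5 * W / 3 + Z / 3)

/-- `∂N_W/∂Z = (Z − W)/3`. [cite: BuckmasterCaolaboraGomezserrano2025, §2.1] -/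
def cNW_Z (W Z : ℂ) : ℂ := (Z - W) / 3

/-- `∂N_Z/∂W = (W − Z)/3`. [cite: BuckmasterCaolaboraGomezserrano2025, §2.1] -/
def cNZ_W (W Z : ℂ) : ℂ := (W - Z) / 3

/-- `∂N_Z/∂Z = −(r + W/3 + 5Z/3)`. [cite: BuckmasterCaolaboraGomezserrano2025, §2.1] -/
def cNZ_Z (r : ℝ) (W Z : ℂ) : ℂ := -((r : ℂ) + W / 3 + 5 * Z / 3)

/-- Quadratic part of `N_W`: `Q_W(α) = −(5/6)α₁² − (1/3)α₁α₂ + (1/6)α₂²`. [folklore] -/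
def qNW (a b : ℂ) : ℂ := -(5 / 6) * (a * a) - 1 / 3 * (a * b) + 1 / 6 * (b * b)

/-- Quadratic part of `N_Z`: `Q_Z(α) = (1/6)α₁² − (1/3)α₁α₂ − (5/6)α₂²`. [folklore] -/
def qNZ (a b : ℂ) : ℂ := 1 / 6 * (a * a) - 1 / 3 * (a * b) - 5 / 6 * (b * b)

/-- Exact expansion of `N_W` around a point. [folklore] -/
theorem cNW_expand (r : ℝ) (W Z a b : ℂ) :
    cNW r (W + a) (Z + b) = cNW r W Z + (cNW_W r W Z * a + cNW_Z W Z * b) + qNW a b := by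
  unfold cNW cNW_W cNW_Z qNW; ring

/-- Exact expansion of `N_Z` around a point. [folklore] -/
theorem cNZ_expand (r : ℝ) (W Z a b : ℂ) :
    cNZ r (W + a) (Z + b) = cNZ r W Z + (cNZ_W W Z * a + cNZ_Z r W Z * b) + qNZ a b := by
  unfold cNZ cNZ_W cNZ_Z qNZ; ring

/-- Exact expansion of `D_W`. [folklore] -/
theorem cDW_expand (W Z a b : ℂ) : cDW (W + a) (Z + b) = cDW W Z + (2 * a + b) / 3 := by unfold cDW; ring

/-- Exact expansion of `D_Z`. [folklore] -/
theorem cDZ_expand (W Z a b : ℂ) : cDZ (W + a) (Z + b) = cDZ W Z + (a + 2 * b) / 3 := by unfold cDZ; ring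

/-- The numerator of `∂(N_W/D_W)/∂W`: `D_W ∂_W N_W − (2/3) N_W`. [folklore] -/
def numWW (r : ℝ) (W Z : ℂ) : ℂ := cDW W Z * cNW_W r W Z - 2 / 3 * cNW r W Z

/-- The numerator of `∂(N_W/D_W)/∂Z`: `D_W ∂_Z N_W − (1/3) N_W`. [folklore] -/
def numWZ (r : ℝ) (W Z : ℂ) : ℂ := cDW W Z * cNW_Z W Z - 1 / 3 * cNW r W Z

/-- The numerator of `∂(N_Z/D_Z)/∂W`: `D_Z ∂_W N_Z − (1/3) N_Z`. [folklore] -/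
def numZW (r : ℝ) (W Z : ℂ) : ℂ := cDZ W Z * cNZ_W W Z - 1 / 3 * cNZ r W Z

/-- The numerator of `∂(N_Z/D_Z)/∂Z`: `D_Z ∂_Z N_Z − (2/3) N_Z`. [folklore] -/
def numZZ (r : ℝ) (W Z : ℂ) : ℂ := cDZ W Z * cNZ_Z r W Z - 2 / 3 * cNZ r W Z

/-- The structured local Lipschitz constant of one component at a point with data
`n = |num_W| + |num_Z|`, `l = |∂_W N| + |∂_Z N|`, `dD = |D|`, radius `g`. [folklore] -/
def lipLoc (n l dD g : ℝ) : ℝ := (n + 8 / 3 * dD * g + 2 * l * g + 4 * g ^ 2) / (dD - g) ^ 2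

/-! ### Elementary bounds -/

section bounds

variable {a b a' b' : ℂ} {g : ℝ}

/-- `|Q_W(α)| ≤ (4/3) g²` on the `g`-ball. [folklore] -/
theorem norm_qNW_le (ha : ‖a‖ ≤ g) (hb : ‖b‖ ≤ g) : ‖qNW a b‖ ≤ 4 / 3 * g ^ 2 := by
  have hg : 0 ≤ g := (norm_nonneg a).trans ha
  unfold qNW
  have h1 : ‖(-(5 / 6) : ℂ) * (a * a)‖ ≤ 5 / 6 * g ^ 2 := by
    rw [norm_mul, norm_mul, show ‖(-(5 / 6) : ℂ)‖ = 5 / 6 by norm_num, sq]; gcongr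
  have h2 : ‖(1 / 3 : ℂ) * (a * b)‖ ≤ 1 / 3 * g ^ 2 := by
    rw [norm_mul, norm_mul, show ‖(1 / 3 : ℂ)‖ = 1 / 3 by norm_num, sq]; gcongr
  have h3 : ‖(1 / 6 : ℂ) * (b * b)‖ ≤ 1 / 6 * g ^ 2 := by
    rw [norm_mul, norm_mul, show ‖(1 / 6 : ℂ)‖ = 1 / 6 by norm_num, sq]; gcongr
  calc ‖-(5 / 6) * (a * a) - 1 / 3 * (a * b) + 1 / 6 * (b * b)‖
      ≤ ‖(-(5 / 6) : ℂ) * (a * a)‖ + ‖(1 / 3 : ℂ) * (a * b)‖ + ‖(1 / 6 : ℂ) * (b * b)‖ :=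
        (norm_add_le _ _).trans (add_le_add (norm_sub_le _ _) le_rfl)
    _ ≤ 4 / 3 * g ^ 2 := by linarith

/-- `|Q_Z(α)| ≤ (4/3) g²` on the `g`-ball. [folklore] -/
theorem norm_qNZ_le (ha : ‖a‖ ≤ g) (hb : ‖b‖ ≤ g) : ‖qNZ a b‖ ≤ 4 / 3 * g ^ 2 := by
  have hg : 0 ≤ g := (norm_nonneg a).trans ha
  unfold qNZ
  have h1 : ‖(1 / 6 : ℂ) * (a * a)‖ ≤ 1 / 6 * g ^ 2 := by
    rw [norm_mul, norm_mul, show ‖(1 / 6 : ℂ)‖ = 1 / 6 by norm_num, sq]; gcongr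
  have h2 : ‖(1 / 3 : ℂ) * (a * b)‖ ≤ 1 / 3 * g ^ 2 := by
    rw [norm_mul, norm_mul, show ‖(1 / 3 : ℂ)‖ = 1 / 3 by norm_num, sq]; gcongr
  have h3 : ‖(5 / 6 : ℂ) * (b * b)‖ ≤ 5 / 6 * g ^ 2 := by
    rw [norm_mul, norm_mul, show ‖(5 / 6 : ℂ)‖ = 5 / 6 by norm_num, sq]; gcongr
  calc ‖1 / 6 * (a * a) - 1 / 3 * (a * b) - 5 / 6 * (b * b)‖
      ≤ ‖(1 / 6 : ℂ) * (a * a)‖ + ‖(1 / 3 : ℂ) * (a * b)‖ + ‖(5 / 6 : ℂ) * (b * b)‖ :=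
        (norm_sub_le _ _).trans (add_le_add (norm_sub_le _ _) le_rfl)
    _ ≤ 4 / 3 * g ^ 2 := by linarith

/-- Lipschitz bound of `Q_W` on the `g`-ball: `|Q_W(α) − Q_W(β)| ≤ (8/3) g · max(|Δ₁|, |Δ₂|)`. [folklore] -/
theorem norm_qNW_sub_le (ha : ‖a‖ ≤ g) (hb : ‖b‖ ≤ g) (ha' : ‖a'‖ ≤ g) (hb' : ‖b'‖ ≤ g) :
    ‖qNW a b - qNW a' b'‖ ≤ 8 / 3 * g * max ‖a - a'‖ ‖b - b'‖ := by
  set m := max ‖a - a'‖ ‖b - b'‖ with hm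
  have hg : 0 ≤ g := (norm_nonneg a).trans ha
  have hm0 : 0 ≤ m := le_trans (norm_nonneg _) (le_max_left _ _)
  have h1 : ‖a - a'‖ ≤ m := le_max_left _ _
  have h2 : ‖b - b'‖ ≤ m := le_max_right _ _
  have e : qNW a b - qNW a' b' = (-(5 / 6) * (a + a') - 1 / 3 * b) * (a - a') + (-(1 / 3) * a' + 1 / 6 * (b + b')) * (b - b') := by
    unfold qNW; ring
  rw [e]
  have hA : ‖(-(5 / 6) * (a + a') - 1 / 3 * b : ℂ)‖ ≤ 5 / 6 * (g + g) + 1 / 3 * g := by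
    calc ‖(-(5 / 6) * (a + a') - 1 / 3 * b : ℂ)‖ ≤ ‖(-(5 / 6) : ℂ) * (a + a')‖ + ‖(1 / 3 : ℂ) * b‖ := norm_sub_le _ _
      _ ≤ 5 / 6 * (g + g) + 1 / 3 * g := by
        rw [norm_mul, norm_mul, show ‖(-(5 / 6) : ℂ)‖ = 5 / 6 by norm_num, show ‖(1 / 3 : ℂ)‖ = 1 / 3 by norm_num]
        gcongr; exact (norm_add_le _ _).trans (add_le_add ha ha')
  have hB : ‖(-(1 / 3) * a' + 1 / 6 * (b + b') : ℂ)‖ ≤ 1 / 3 * g + 1 / 6 * (g + g) := by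
    calc ‖(-(1 / 3) * a' + 1 / 6 * (b + b') : ℂ)‖ ≤ ‖(-(1 / 3) : ℂ) * a'‖ + ‖(1 / 6 : ℂ) * (b + b')‖ := norm_add_le _ _
      _ ≤ 1 / 3 * g + 1 / 6 * (g + g) := by
        rw [norm_mul, norm_mul, show ‖(-(1 / 3) : ℂ)‖ = 1 / 3 by norm_num, show ‖(1 / 6 : ℂ)‖ = 1 / 6 by norm_num]
        gcongr; exact (norm_add_le _ _).trans (add_le_add hb hb')
  calc ‖(-(5 / 6) * (a + a') - 1 / 3 * b) * (a - a') + (-(1 / 3) * a' + 1 / 6 * (b + b')) * (b - b')‖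
      ≤ ‖(-(5 / 6) * (a + a') - 1 / 3 * b : ℂ)‖ * ‖a - a'‖ + ‖(-(1 / 3) * a' + 1 / 6 * (b + b') : ℂ)‖ * ‖b - b'‖ := by
        refine (norm_add_le _ _).trans ?_; rw [norm_mul, norm_mul]
    _ ≤ (5 / 6 * (g + g) + 1 / 3 * g) * m + (1 / 3 * g + 1 / 6 * (g + g)) * m := by gcongr
    _ = 8 / 3 * g * m := by ring

/-- Lipschitz bound of `Q_Z` on the `g`-ball. [folklore] -/
theorem norm_qNZ_sub_le (ha : ‖a‖ ≤ g) (hb : ‖b‖ ≤ g) (ha' : ‖a'‖ ≤ g) (hb' : ‖b'‖ ≤ g) :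
    ‖qNZ a b - qNZ a' b'‖ ≤ 8 / 3 * g * max ‖a - a'‖ ‖b - b'‖ := by
  set m := max ‖a - a'‖ ‖b - b'‖ with hm
  have hg : 0 ≤ g := (norm_nonneg a).trans ha
  have hm0 : 0 ≤ m := le_trans (norm_nonneg _) (le_max_left _ _)
  have h1 : ‖a - a'‖ ≤ m := le_max_left _ _
  have h2 : ‖b - b'‖ ≤ m := le_max_right _ _
  have e : qNZ a b - qNZ a' b' = (1 / 6 * (a + a') - 1 / 3 * b) * (a - a') + (-(1 / 3) * a' - 5 / 6 * (b + b')) * (b - b') := by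
    unfold qNZ; ring
  rw [e]
  have hA : ‖(1 / 6 * (a + a') - 1 / 3 * b : ℂ)‖ ≤ 1 / 6 * (g + g) + 1 / 3 * g := by
    calc ‖(1 / 6 * (a + a') - 1 / 3 * b : ℂ)‖ ≤ ‖(1 / 6 : ℂ) * (a + a')‖ + ‖(1 / 3 : ℂ) * b‖ := norm_sub_le _ _
      _ ≤ 1 / 6 * (g + g) + 1 / 3 * g := by
        rw [norm_mul, norm_mul, show ‖(1 / 6 : ℂ)‖ = 1 / 6 by norm_num, show ‖(1 / 3 : ℂ)‖ = 1 / 3 by norm_num]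
        gcongr; exact (norm_add_le _ _).trans (add_le_add ha ha')
  have hB : ‖(-(1 / 3) * a' - 5 / 6 * (b + b') : ℂ)‖ ≤ 1 / 3 * g + 5 / 6 * (g + g) := by
    calc ‖(-(1 / 3) * a' - 5 / 6 * (b + b') : ℂ)‖ ≤ ‖(-(1 / 3) : ℂ) * a'‖ + ‖(5 / 6 : ℂ) * (b + b')‖ := norm_sub_le _ _
      _ ≤ 1 / 3 * g + 5 / 6 * (g + g) := by
        rw [norm_mul, norm_mul, show ‖(-(1 / 3) : ℂ)‖ = 1 / 3 by norm_num, show ‖(5 / 6 : ℂ)‖ = 5 / 6 by norm_num]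
        gcongr; exact (norm_add_le _ _).trans (add_le_add hb hb')
  calc ‖(1 / 6 * (a + a') - 1 / 3 * b) * (a - a') + (-(1 / 3) * a' - 5 / 6 * (b + b')) * (b - b')‖
      ≤ ‖(1 / 6 * (a + a') - 1 / 3 * b : ℂ)‖ * ‖a - a'‖ + ‖(-(1 / 3) * a' - 5 / 6 * (b + b') : ℂ)‖ * ‖b - b'‖ := by
        refine (norm_add_le _ _).trans ?_; rw [norm_mul, norm_mul]
    _ ≤ (1 / 6 * (g + g) + 1 / 3 * g) * m + (1 / 3 * g + 5 / 6 * (g + g)) * m := by gcongr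
    _ = 8 / 3 * g * m := by ring

/-- `|(2a + b)/3| ≤ max(|a|, |b|)`. [folklore] -/
theorem norm_lW_le (a b : ℂ) : ‖(2 * a + b) / 3‖ ≤ max ‖a‖ ‖b‖ := by
  have h := norm_cDW_sub_le a b 0 0
  have e : cDW a b - cDW 0 0 = (2 * a + b) / 3 := by unfold cDW; ring
  rw [e] at h; simpa using h

/-- `|(a + 2b)/3| ≤ max(|a|, |b|)`. [folklore] -/
theorem norm_lZ_le (a b : ℂ) : ‖(a + 2 * b) / 3‖ ≤ max ‖a‖ ‖b‖ := by
  have h := norm_cDZ_sub_le a b 0 0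
  have e : cDZ a b - cDZ 0 0 = (a + 2 * b) / 3 := by unfold cDZ; ring
  rw [e] at h; simpa using h

/-- A linear form bounded by the `ℓ¹`-norm of its coefficients times the sup norm. [folklore] -/
theorem norm_lin_le (c₁ c₂ a b : ℂ) : ‖c₁ * a + c₂ * b‖ ≤ (‖c₁‖ + ‖c₂‖) * max ‖a‖ ‖b‖ := by
  have h1 : ‖a‖ ≤ max ‖a‖ ‖b‖ := le_max_left _ _
  have h2 : ‖b‖ ≤ max ‖a‖ ‖b‖ := le_max_right _ _
  calc ‖c₁ * a + c₂ * b‖ ≤ ‖c₁‖ * ‖a‖ + ‖c₂‖ * ‖b‖ := by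
        refine (norm_add_le _ _).trans ?_; rw [norm_mul, norm_mul]
    _ ≤ ‖c₁‖ * max ‖a‖ ‖b‖ + ‖c₂‖ * max ‖a‖ ‖b‖ := by gcongr
    _ = (‖c₁‖ + ‖c₂‖) * max ‖a‖ ‖b‖ := by ring

end bounds

/-! ### The structured estimate for one quotient -/

/-- **The structured local Lipschitz estimate for a quotient `N/D`** with `N = N(p) + L + Q` quadratic and `D = D(p) + ℓ` affine
around a point: for `α, β` in the `g`-ball (sup norm) and `|D(p)| > g`,
`|N(p+α)/D(p+α) − N(p+β)/D(p+β)| ≤ lipLoc(n, l, |D(p)|, g) · ‖α − β‖`, where `n` bounds the numerator linear form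
`(D(p)L − N(p)ℓ)(α − β)` per unit `‖α − β‖` and `l` the `ℓ¹` norm of `L`. Abstract version (all structure as hypotheses).
[folklore] -/
theorem norm_quot_sub_quot_le {Np Dp La Lb Ld Qa Qb la lb : ℂ} {n l dD g m : ℝ} (hg : 0 ≤ g) (hgd : g < dD)
    (hDp : ‖Dp‖ = dD) (hm : 0 ≤ m)
    (hmain : ‖Dp * Ld + Np * (lb - la)‖ ≤ n * m)
    (hLa : ‖La‖ ≤ l * g) (hLd : ‖Ld‖ ≤ l * m) (hla : ‖la‖ ≤ g) (hlb : ‖lb‖ ≤ g) (hlab : ‖lb - la‖ ≤ m)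
    (hQa : ‖Qa‖ ≤ 4 / 3 * g ^ 2) (hQab : ‖Qa - Qb‖ ≤ 8 / 3 * g * m) (hLdiff : La - Lb = Ld) :
    ‖(Np + La + Qa) / (Dp + la) - (Np + Lb + Qb) / (Dp + lb)‖ ≤ lipLoc n l dD g * m := by
  have hDa : dD - g ≤ ‖Dp + la‖ := by
    have := norm_sub_norm_le Dp (-la); rw [norm_neg, sub_neg_eq_add] at this; linarith
  have hDb : dD - g ≤ ‖Dp + lb‖ := by
    have := norm_sub_norm_le Dp (-lb); rw [norm_neg, sub_neg_eq_add] at this; linarith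
  have hpos : 0 < dD - g := by linarith
  have hDa0 : Dp + la ≠ 0 := fun h => by rw [h, norm_zero] at hDa; linarith
  have hDb0 : Dp + lb ≠ 0 := fun h => by rw [h, norm_zero] at hDb; linarith
  -- the algebraic identity
  have e : (Np + La + Qa) / (Dp + la) - (Np + Lb + Qb) / (Dp + lb) =
      ((Dp * Ld + Np * (lb - la)) + Dp * (Qa - Qb) + (La * (lb - la) + Ld * la) + (Qa * (lb - la) + (Qa - Qb) * la))
        / ((Dp + la) * (Dp + lb)) := by
    rw [← hLdiff]; field_simp; ring
  rw [e, norm_div, norm_mul]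
  have hdD : 0 ≤ dD := by linarith
  have hnum : ‖(Dp * Ld + Np * (lb - la)) + Dp * (Qa - Qb) + (La * (lb - la) + Ld * la) + (Qa * (lb - la) + (Qa - Qb) * la)‖
      ≤ n * m + dD * (8 / 3 * g * m) + (l * g * m + l * m * g) + (4 / 3 * g ^ 2 * m + 8 / 3 * g * m * g) := by
    have t2 : ‖Dp * (Qa - Qb)‖ ≤ dD * (8 / 3 * g * m) := by rw [norm_mul, hDp]; gcongr
    have t3 : ‖La * (lb - la) + Ld * la‖ ≤ l * g * m + l * m * g := by
      calc ‖La * (lb - la) + Ld * la‖ ≤ ‖La‖ * ‖lb - la‖ + ‖Ld‖ * ‖la‖ := by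
            refine (norm_add_le _ _).trans ?_; rw [norm_mul, norm_mul]
        _ ≤ l * g * m + l * m * g := by
            have hl : 0 ≤ l * g := (norm_nonneg _).trans hLa
            have hl' : 0 ≤ l * m := (norm_nonneg _).trans hLd
            gcongr
    have t4 : ‖Qa * (lb - la) + (Qa - Qb) * la‖ ≤ 4 / 3 * g ^ 2 * m + 8 / 3 * g * m * g := by
      calc ‖Qa * (lb - la) + (Qa - Qb) * la‖ ≤ ‖Qa‖ * ‖lb - la‖ + ‖Qa - Qb‖ * ‖la‖ := by
            refine (norm_add_le _ _).trans ?_; rw [norm_mul, norm_mul]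
        _ ≤ 4 / 3 * g ^ 2 * m + 8 / 3 * g * m * g := by
            have h1 : 0 ≤ 4 / 3 * g ^ 2 := by positivity
            have h2 : 0 ≤ 8 / 3 * g * m := by positivity
            gcongr
    calc _ ≤ ‖(Dp * Ld + Np * (lb - la)) + Dp * (Qa - Qb) + (La * (lb - la) + Ld * la)‖ + ‖Qa * (lb - la) + (Qa - Qb) * la‖ :=
          norm_add_le _ _
      _ ≤ (‖(Dp * Ld + Np * (lb - la)) + Dp * (Qa - Qb)‖ + ‖La * (lb - la) + Ld * la‖) + ‖Qa * (lb - la) + (Qa - Qb) * la‖ := by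
          gcongr; exact norm_add_le _ _
      _ ≤ ((‖Dp * Ld + Np * (lb - la)‖ + ‖Dp * (Qa - Qb)‖) + ‖La * (lb - la) + Ld * la‖) + ‖Qa * (lb - la) + (Qa - Qb) * la‖ := by
          gcongr; exact norm_add_le _ _
      _ ≤ _ := by linarith
  have hden : (dD - g) ^ 2 ≤ ‖Dp + la‖ * ‖Dp + lb‖ := by
    rw [sq]; exact mul_le_mul hDa hDb hpos.le (norm_nonneg _)
  have hnum0 : 0 ≤ n * m + dD * (8 / 3 * g * m) + (l * g * m + l * m * g) + (4 / 3 * g ^ 2 * m + 8 / 3 * g * m * g) :=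
    (norm_nonneg _).trans hnum
  calc _ ≤ (n * m + dD * (8 / 3 * g * m) + (l * g * m + l * m * g) + (4 / 3 * g ^ 2 * m + 8 / 3 * g * m * g)) / (‖Dp + la‖ * ‖Dp + lb‖) := by
        gcongr
    _ ≤ (n * m + dD * (8 / 3 * g * m) + (l * g * m + l * m * g) + (4 / 3 * g ^ 2 * m + 8 / 3 * g * m * g)) / (dD - g) ^ 2 :=
        div_le_div_of_nonneg_left hnum0 (by positivity) hden
    _ = lipLoc n l dD g * m := by unfold lipLoc; field_simp; ring

/-! ### The field -/

/-- **The structured local Lipschitz bound of the complexified field on a tube cross-section.** At a point `p = (W, Z)` with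
`|numWW| + |numWZ| ≤ nW`, `|∂_W N_W| + |∂_Z N_W| ≤ lW`, `|D_W| = dW > g` (and the `Z` analogues), for `u, v` in the closed
sup-norm ball of radius `g` around `p`: `‖F(u) − F(v)‖ ≤ max(lipLoc nW lW dW g, lipLoc nZ lZ dZ g) · ‖u − v‖`.
[cite: Hille1976, §2.3] -/
theorem lipschitz_cfield_local {r : ℝ} {W Z : ℂ} {nW lW nZ lZ g : ℝ} (hg : 0 ≤ g)
    (hgW : g < ‖cDW W Z‖) (hgZ : g < ‖cDZ W Z‖)
    (hnW : ‖numWW r W Z‖ + ‖numWZ r W Z‖ ≤ nW) (hlW : ‖cNW_W r W Z‖ + ‖cNW_Z W Z‖ ≤ lW)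
    (hnZ : ‖numZW r W Z‖ + ‖numZZ r W Z‖ ≤ nZ) (hlZ : ‖cNZ_W W Z‖ + ‖cNZ_Z r W Z‖ ≤ lZ) :
    ∀ u ∈ closedBall ((W, Z) : ℂ × ℂ) g, ∀ v ∈ closedBall ((W, Z) : ℂ × ℂ) g,
      ‖cfield r u - cfield r v‖ ≤ max (lipLoc nW lW ‖cDW W Z‖ g) (lipLoc nZ lZ ‖cDZ W Z‖ g) * ‖u - v‖ := by
  intro u hu v hv
  -- coordinates relative to `p`
  set a := u.1 - W with ha
  set b := u.2 - Z with hb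
  set a' := v.1 - W with ha'
  set b' := v.2 - Z with hb'
  rw [mem_closedBall, dist_eq_norm, Prod.norm_def] at hu hv
  have hua : ‖a‖ ≤ g := le_trans (le_max_left _ _) hu
  have hub : ‖b‖ ≤ g := le_trans (le_max_right _ _) hu
  have hva : ‖a'‖ ≤ g := le_trans (le_max_left _ _) hv
  have hvb : ‖b'‖ ≤ g := le_trans (le_max_right _ _) hv
  set m := ‖u - v‖ with hm
  have hm0 : 0 ≤ m := norm_nonneg _
  have hmeq : max ‖a - a'‖ ‖b - b'‖ = m := by
    have e1 : a - a' = (u - v).1 := by rw [ha, ha', Prod.fst_sub]; ring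
    have e2 : b - b' = (u - v).2 := by rw [hb, hb', Prod.snd_sub]; ring
    rw [e1, e2, hm, Prod.norm_def]
  have hu1 : u.1 = W + a := by rw [ha]; ring
  have hu2 : u.2 = Z + b := by rw [hb]; ring
  have hv1 : v.1 = W + a' := by rw [ha']; ring
  have hv2 : v.2 = Z + b' := by rw [hb']; ring
  -- component W
  have hW : ‖cNW r u.1 u.2 / cDW u.1 u.2 - cNW r v.1 v.2 / cDW v.1 v.2‖ ≤ lipLoc nW lW ‖cDW W Z‖ g * m := by
    rw [hu1, hu2, hv1, hv2, cNW_expand, cNW_expand, cDW_expand, cDW_expand]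
    refine norm_quot_sub_quot_le (Ld := cNW_W r W Z * (a - a') + cNW_Z W Z * (b - b')) hg hgW rfl hm0 ?_ ?_ ?_
      (norm_lW_le a b |>.trans hu) (norm_lW_le a' b' |>.trans hv) ?_ (norm_qNW_le hua hub)
      (by rw [← hmeq]; exact norm_qNW_sub_le hua hub hva hvb) (by ring)
    · -- main term: `D_W L(α−β) − N_W ℓ(β−α) = numWW·(a−a') + numWZ·(b−b')`
      have e : cDW W Z * (cNW_W r W Z * (a - a') + cNW_Z W Z * (b - b')) + cNW r W Z * ((2 * a' + b') / 3 - (2 * a + b) / 3)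
          = numWW r W Z * (a - a') + numWZ r W Z * (b - b') := by unfold numWW numWZ; ring
      rw [e, ← hmeq]
      exact (norm_lin_le _ _ _ _).trans (mul_le_mul_of_nonneg_right hnW (by rw [hmeq]; exact hm0))
    · calc ‖cNW_W r W Z * a + cNW_Z W Z * b‖ ≤ (‖cNW_W r W Z‖ + ‖cNW_Z W Z‖) * max ‖a‖ ‖b‖ := norm_lin_le _ _ _ _
        _ ≤ lW * g := mul_le_mul hlW hu (le_trans (norm_nonneg _) (le_max_left _ _)) ((add_nonneg (norm_nonneg _) (norm_nonneg _)).trans hlW)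
    · calc ‖cNW_W r W Z * (a - a') + cNW_Z W Z * (b - b')‖ ≤ (‖cNW_W r W Z‖ + ‖cNW_Z W Z‖) * max ‖a - a'‖ ‖b - b'‖ :=
          norm_lin_le _ _ _ _
        _ ≤ lW * m := by rw [hmeq]; exact mul_le_mul_of_nonneg_right hlW hm0
    · have h := norm_lW_le (a' - a) (b' - b)
      have e : (2 * a' + b') / 3 - (2 * a + b) / 3 = (2 * (a' - a) + (b' - b)) / 3 := by ring
      rw [e]
      refine h.trans ?_
      rw [← hmeq, norm_sub_rev a' a, norm_sub_rev b' b]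
  -- component Z
  have hZc : ‖cNZ r u.1 u.2 / cDZ u.1 u.2 - cNZ r v.1 v.2 / cDZ v.1 v.2‖ ≤ lipLoc nZ lZ ‖cDZ W Z‖ g * m := by
    rw [hu1, hu2, hv1, hv2, cNZ_expand, cNZ_expand, cDZ_expand, cDZ_expand]
    refine norm_quot_sub_quot_le (Ld := cNZ_W W Z * (a - a') + cNZ_Z r W Z * (b - b')) hg hgZ rfl hm0 ?_ ?_ ?_
      (norm_lZ_le a b |>.trans hu) (norm_lZ_le a' b' |>.trans hv) ?_ (norm_qNZ_le hua hub)
      (by rw [← hmeq]; exact norm_qNZ_sub_le hua hub hva hvb) (by ring)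
    · have e : cDZ W Z * (cNZ_W W Z * (a - a') + cNZ_Z r W Z * (b - b')) + cNZ r W Z * ((a' + 2 * b') / 3 - (a + 2 * b) / 3)
          = numZW r W Z * (a - a') + numZZ r W Z * (b - b') := by unfold numZW numZZ; ring
      rw [e, ← hmeq]
      exact (norm_lin_le _ _ _ _).trans (mul_le_mul_of_nonneg_right hnZ (by rw [hmeq]; exact hm0))
    · calc ‖cNZ_W W Z * a + cNZ_Z r W Z * b‖ ≤ (‖cNZ_W W Z‖ + ‖cNZ_Z r W Z‖) * max ‖a‖ ‖b‖ := norm_lin_le _ _ _ _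
        _ ≤ lZ * g := mul_le_mul hlZ hu (le_trans (norm_nonneg _) (le_max_left _ _)) ((add_nonneg (norm_nonneg _) (norm_nonneg _)).trans hlZ)
    · calc ‖cNZ_W W Z * (a - a') + cNZ_Z r W Z * (b - b')‖ ≤ (‖cNZ_W W Z‖ + ‖cNZ_Z r W Z‖) * max ‖a - a'‖ ‖b - b'‖ :=
          norm_lin_le _ _ _ _
        _ ≤ lZ * m := by rw [hmeq]; exact mul_le_mul_of_nonneg_right hlZ hm0
    · have h := norm_lZ_le (a' - a) (b' - b)
      have e : (a' + 2 * b') / 3 - (a + 2 * b) / 3 = ((a' - a) + 2 * (b' - b)) / 3 := by ring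
      rw [e]
      refine h.trans ?_
      rw [← hmeq, norm_sub_rev a' a, norm_sub_rev b' b]
  have e : cfield r u - cfield r v = (cNW r u.1 u.2 / cDW u.1 u.2 - cNW r v.1 v.2 / cDW v.1 v.2,
      cNZ r u.1 u.2 / cDZ u.1 u.2 - cNZ r v.1 v.2 / cDZ v.1 v.2) := rfl
  rw [e, Prod.norm_def]
  exact max_le (hW.trans (mul_le_mul_of_nonneg_right (le_max_left _ _) hm0))
    (hZc.trans (mul_le_mul_of_nonneg_right (le_max_right _ _) hm0))

end ComplexDisc

end Monatomic

end BuckmasterCaolaboraGomezserrano2025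

end Literature.Analysis.FluidPDE
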